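import Mathlib
import Summits.NavierStokesRegularity.NavierStokesRegularity.Theorems.TaoLadderRungTwoBreakBlowupRigidityOneFrontBundle
import Summits.NavierStokesRegularity.NavierStokesRegularity.Theorems.TaoLadderRungTwoBreakBlowupRigidityOneLinks
import HarnessLib

/-!
# BY-NAME CLOSES-SHAPED LINKS for the type-I-free extraction: what the THREE-ITEM FRONT BUNDLE decides in route
  TaoLadderRungTwoBreak — crux K2(1) `BlowupRigidityOne` (stmt-NavierStokesRegularity-20206), the rung leaf `Target`

MODEL lattice ODEs only (Tao 2016 §4, §6.4); nothing here is a statement about the Navier–Stokes equations; NO item is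
closed (`--supports stmt-NavierStokesRegularity-20206`): every theorem is CONDITIONAL on the open front bundle.

With `stub_eternalFromBlowup_of_fronts` (this hand) and the previous hand's link web (`…Links.lean`):

* `blowupRigidityOne_of_fronts_of_classification` — front bundle + the classification stub `stub_eternalIsDSS` (quoted
  verbatim) ⇒ the CRUX `BlowupRigidityOne` (the registered skeleton's composition with its extraction stub DISCHARGED
  modulo the bundle);
* `target_of_fronts_of_noSurvivingEternalFwdOne` — front bundle + K1^∞_fwd(1) (the inviscid eternal Liouville statement
  `NoSurvivingEternalFwd R 1`, every `R ≥ 1`) ⇒ the route's rung leaf `Target` (no classification needed);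
* `blowupRigidityOne_of_fronts_of_noSurvivingEternalFwdOne` — hence also the crux (vacuously through the `Target`).

HONEST LABEL: conditional by-name bookkeeping; the three-item front bundle (asymptotic self-similarity of robust inviscid
blow-up at fixed spread) and the Liouville / classification statements are OPEN; no stub, crux or summit is proved.
-/

noncomputable section

-- the summit and its single sub-problem share the name (CONVENTIONS §1)
set_option linter.dupNamespace false

open Set Filter Topology MeasureTheory

namespace Summit.NavierStokesRegularity.NavierStokesRegularity.Theorems

namespace BlowupRigidityOne

open Literature.Analysis.FluidPDE Literature.Analysis.FluidPDE.TaoCascade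
open Summit.NavierStokesRegularity.NavierStokesRegularity.Theses.TaoLadderRungTwoBreak

/-- **FRONT BUNDLE + CLASSIFICATION ⇒ THE CRUX K2(1).** The registered skeleton `BlowupRigidityOne_of stub_eternalFromBlowup
stub_eternalIsDSS` with its extraction stub discharged modulo the three-item front bundle (`stub_eternalFromBlowup_of_fronts`)
and the classification stub `stub_eternalIsDSS` kept as a hypothesis (quoted verbatim).
[cite: Tao2016AveragedNS, §4 Thm. 4.2 (statement shape), §6.4; cell vocabulary] -/
theorem blowupRigidityOne_of_fronts_of_classification
    (H : ∀ R : ℝ, 1 ≤ R → ∃ εs : ℝ, 0 < εs ∧ ∀ ε₀ : ℝ, 0 < ε₀ → ε₀ ≤ εs →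
      ∀ (α : (Fin 4 → Fin 4 → Fin 4 → ℤ × ℤ × ℤ → ℝ)) (X₀ : Fin 4 → ℝ),
        InTableClass R α → NoGlobalCascade ε₀ α X₀ →
        ∃ (T A B ν cf κ₂ : ℝ) (X : Fin 4 → ℤ → ℝ → ℝ), 0 < T ∧
          (∀ i n, ContDiffOn ℝ 1 (X i n) (Set.Ico 0 T)) ∧
          (∀ i n t, 0 ≤ t → t < T → derivWithin (X i n) (Set.Ici 0) t = quadTerm ε₀ α X i n t) ∧
          (∀ k : ℤ, IntegrableOn (fun t => ‖shellVec X k t‖) (Ico 0 T) ∧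
            bigLam ε₀ ^ k * (∫ t in Ico 0 T, ‖shellVec X k t‖) ≤ A) ∧
          0 < ν ∧ (1 + ε₀)⁻¹ ≤ ν ^ 2 ∧
          (∀ (j : ℤ) (t : ℝ), 0 ≤ t → t < T → ‖shellVec X j t‖ ≤ B * ν ^ j) ∧
          0 < cf ∧ 0 < κ₂ ∧
          (∀ k : ℕ, ∃ t : ℝ, 0 ≤ t ∧ t < T ∧ cf * (ν ^ 2) ^ k ≤ ‖shellVec X (k : ℤ) t‖ ^ 2 ∧
            (bigLam ε₀ ^ 2 * ν ^ 2) ^ k * (T - t) ^ 2 ≤ κ₂))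
    (hDSS : ∀ R : ℝ, 1 ≤ R → ∃ εs : ℝ, 0 < εs ∧ ∀ ε₀ : ℝ, 0 < ε₀ → ε₀ ≤ εs →
      ∀ α : (Fin 4 → Fin 4 → Fin 4 → ℤ × ℤ × ℤ → ℝ), InTableClass R α →
        (∃ W : ℤ → ℝ → Em 4, IsEternal ε₀ α W ∧ EternalSurvivingFwd 1 ε₀ W) →
          ∃ (q : ℕ) (π : Equiv.Perm (Fin q)) (T : ℝ) (Φ : Fin q → ℝ → Em 4),
            IsDSSWave ε₀ α π T Φ ∧ Surviving 1 ε₀ T ∧ ∃ r x, Φ r x ≠ 0) :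
    Summit.NavierStokesRegularity.NavierStokesRegularity.Theses.TaoLadderRungTwoBreak.BlowupRigidityOne :=
  blowupRigidityOne_of_stubs (stub_eternalFromBlowup_of_fronts H) hDSS

/-- **FRONT BUNDLE + K1^∞_fwd(1) ⇒ THE RUNG LEAF `Target`** (no classification): the inviscid eternal Liouville statement
`NoSurvivingEternalFwd R 1` (every `R ≥ 1`) forbids the surviving eternal solution that the front bundle extracts from a
robust blow-up, so below the combined threshold no table of `E₂(R)` blows up robustly.
[cite: Tao2016AveragedNS, §4 Thm. 4.2 (statement shape), §6.4; cell vocabulary] -/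
theorem target_of_fronts_of_noSurvivingEternalFwdOne
    (H : ∀ R : ℝ, 1 ≤ R → ∃ εs : ℝ, 0 < εs ∧ ∀ ε₀ : ℝ, 0 < ε₀ → ε₀ ≤ εs →
      ∀ (α : (Fin 4 → Fin 4 → Fin 4 → ℤ × ℤ × ℤ → ℝ)) (X₀ : Fin 4 → ℝ),
        InTableClass R α → NoGlobalCascade ε₀ α X₀ →
        ∃ (T A B ν cf κ₂ : ℝ) (X : Fin 4 → ℤ → ℝ → ℝ), 0 < T ∧
          (∀ i n, ContDiffOn ℝ 1 (X i n) (Set.Ico 0 T)) ∧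
          (∀ i n t, 0 ≤ t → t < T → derivWithin (X i n) (Set.Ici 0) t = quadTerm ε₀ α X i n t) ∧
          (∀ k : ℤ, IntegrableOn (fun t => ‖shellVec X k t‖) (Ico 0 T) ∧
            bigLam ε₀ ^ k * (∫ t in Ico 0 T, ‖shellVec X k t‖) ≤ A) ∧
          0 < ν ∧ (1 + ε₀)⁻¹ ≤ ν ^ 2 ∧
          (∀ (j : ℤ) (t : ℝ), 0 ≤ t → t < T → ‖shellVec X j t‖ ≤ B * ν ^ j) ∧
          0 < cf ∧ 0 < κ₂ ∧
          (∀ k : ℕ, ∃ t : ℝ, 0 ≤ t ∧ t < T ∧ cf * (ν ^ 2) ^ k ≤ ‖shellVec X (k : ℤ) t‖ ^ 2 ∧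
            (bigLam ε₀ ^ 2 * ν ^ 2) ^ k * (T - t) ^ 2 ≤ κ₂))
    (h0 : ∀ R : ℝ, 1 ≤ R → NoSurvivingEternalFwd R 1) :
    Summit.NavierStokesRegularity.NavierStokesRegularity.Theses.TaoLadderRungTwoBreak.Target :=
  target_of_stubEternalFromBlowup_of_noSurvivingEternalFwdOne (stub_eternalFromBlowup_of_fronts H) h0

/-- **FRONT BUNDLE + K1^∞_fwd(1) ⇒ THE CRUX K2(1)** (vacuously, through the `Target`).
[cite: Tao2016AveragedNS, §4 Thm. 4.2 (statement shape), §6.4; cell vocabulary] -/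
theorem blowupRigidityOne_of_fronts_of_noSurvivingEternalFwdOne
    (H : ∀ R : ℝ, 1 ≤ R → ∃ εs : ℝ, 0 < εs ∧ ∀ ε₀ : ℝ, 0 < ε₀ → ε₀ ≤ εs →
      ∀ (α : (Fin 4 → Fin 4 → Fin 4 → ℤ × ℤ × ℤ → ℝ)) (X₀ : Fin 4 → ℝ),
        InTableClass R α → NoGlobalCascade ε₀ α X₀ →
        ∃ (T A B ν cf κ₂ : ℝ) (X : Fin 4 → ℤ → ℝ → ℝ), 0 < T ∧
          (∀ i n, ContDiffOn ℝ 1 (X i n) (Set.Ico 0 T)) ∧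
          (∀ i n t, 0 ≤ t → t < T → derivWithin (X i n) (Set.Ici 0) t = quadTerm ε₀ α X i n t) ∧
          (∀ k : ℤ, IntegrableOn (fun t => ‖shellVec X k t‖) (Ico 0 T) ∧
            bigLam ε₀ ^ k * (∫ t in Ico 0 T, ‖shellVec X k t‖) ≤ A) ∧
          0 < ν ∧ (1 + ε₀)⁻¹ ≤ ν ^ 2 ∧
          (∀ (j : ℤ) (t : ℝ), 0 ≤ t → t < T → ‖shellVec X j t‖ ≤ B * ν ^ j) ∧
          0 < cf ∧ 0 < κ₂ ∧
          (∀ k : ℕ, ∃ t : ℝ, 0 ≤ t ∧ t < T ∧ cf * (ν ^ 2) ^ k ≤ ‖shellVec X (k : ℤ) t‖ ^ 2 ∧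
            (bigLam ε₀ ^ 2 * ν ^ 2) ^ k * (T - t) ^ 2 ≤ κ₂))
    (h0 : ∀ R : ℝ, 1 ≤ R → NoSurvivingEternalFwd R 1) :
    Summit.NavierStokesRegularity.NavierStokesRegularity.Theses.TaoLadderRungTwoBreak.BlowupRigidityOne :=
  blowupRigidityOne_of_target (target_of_fronts_of_noSurvivingEternalFwdOne H h0)

end BlowupRigidityOne

end Summit.NavierStokesRegularity.NavierStokesRegularity.Theorems

end
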